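import Summits.Ventures.YMGap.RobustBall.ScreenedStabilityS
import HarnessLib

/-!
# Venture YMGap, track ROBUST-BALL (Y2) — TIER 2: expectations along a line `s ↦ W + sV` in the weighted ball are the UNIFORM
# limits of the expectations along the truncated lines `s ↦ W + sV_T` (finitely many terms of the direction switched on)

HONEST FRAMING. WHAT THIS IS: a venture file (cell `pub-ymgap`, track Y2 ROBUST-BALL, seat rb-p1, theorems only), the convergence half
of `StateDerivativeOnBallS.lean`.  A member `W ∈ MemBallZdS a Λ t` and a direction `V ∈ MemBallZdS a_V Λ_V t` with
`a + s₀ a_V ≤ a'`, `Λ + s₀ Λ_V ≤ Λ'` and the pair door `ρ' := 6(d−1)|β| e^{a'} e^{t} √(cv) + e^{a'/2} √c Λ'_t < 1` at the bigger loads: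
every `W + sV`, `|s| ≤ s₀`, and every TRUNCATION `W + s·𝟙_T V` (`T` any set of terms) is a member at loads `(a', Λ')`.
* `memBallZdS_indicator`, `memBallZdS_add_smul_indicator` — truncated directions and truncated lines stay in the ball;
* `add_smul_indicator_add_compl` — `(W + s·𝟙_T V) + s·𝟙_{Tᶜ} V = W + sV`; `oscLoad_compl_indicator` — the one-link oscillation loads of
  the switched-off remainder `s·𝟙_{Tᶜ} V` are `|s|·Σ'_{X ∋ e, X ∉ T} osc_X(e)`, and `tendsto_tail_oscLoad` — they tend to `0` at every link
  along any exhausting sequence `T_n ↑` of finite term sets (`Tendsto T atTop atTop`);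
* `finite_near_links` — the links within `ℓ^∞`-distance `r` of a nonempty finite link set form a finite set;
* ★ `tendstoUniformlyOn_integral_truncation_S` — for EVERY selection of DLR states `ν_n(s) ∈ 𝒢(W + s·𝟙_{T_n} V)`, `ν(s) ∈ 𝒢(W + sV)` and
  every bounded local Frobenius-Lipschitz observable `g`: `∫ g dν_n(s) → ∫ g dν(s)` UNIFORMLY in `|s| ≤ s₀` — by SCREENED STATE STABILITY
  (`abs_integral_sub_integral_le_of_perturbation_screened_S`): the remainder's loads vanish near the observable in the limit and are
  `≤ s₀ a_V` far away, screened by `e^{−t r}` for every `r`.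
WHAT THIS IS NOT: nothing about uniqueness beyond the door; lattice strong coupling only; nothing about the continuum limit or a Clay-sense
mass gap.
-/

noncomputable section

open MeasureTheory Function Finset ProbabilityTheory Real Filter Topology
open scoped NNReal
open Literature.Probability.LatticeModels
open Literature.Probability.LatticeModels.DobrushinMetric
open Literature.MathematicalPhysics.QuantumLattice
open Literature.MathematicalPhysics.QuantumFieldTheory hiding ZdEdge

namespace Summit.Ventures.YMGap.RobustBall

variable {d N : ℕ}

/-! ### Truncated directions -/

section Truncation

variable {G : Type*} {V : Potential (ZdEdge d) G} {T : Set (Finset (ZdEdge d))}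

/-- A truncation of a potential is supported by the (constant) finite family of its switched-on terms. -/
theorem isSupportedBy_indicator [DecidableEq (ZdEdge d)] (Tf : Finset (Finset (ZdEdge d))) (V : Potential (ZdEdge d) G) :
    Potential.IsSupportedBy ((↑Tf : Set (Finset (ZdEdge d))).indicator V) fun _ => Tf := by
  intro Λ A _ hA
  by_contra hAT
  exact hA (Set.indicator_of_notMem (show A ∉ (↑Tf : Set (Finset (ZdEdge d))) from fun h => hAT (Finset.mem_coe.1 h)) V)

/-- Terms of a truncation are terms of `V` or zero: continuity. -/
theorem continuous_indicator_apply [TopologicalSpace G] (hVc : ∀ X, Continuous (V X)) (X : Finset (ZdEdge d)) :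
    Continuous (T.indicator V X) := by
  classical
  rw [Set.indicator_apply]
  split_ifs
  · exact hVc X
  · exact continuous_const

/-- Terms of a truncation depend on their own links. -/
theorem dependsOn_indicator_apply (hVdep : ∀ X, DependsOn (V X) (↑X : Set (ZdEdge d))) (X : Finset (ZdEdge d)) :
    DependsOn (T.indicator V X) (↑X : Set (ZdEdge d)) := by
  classical
  intro σ τ h
  rw [Set.indicator_apply]
  split_ifs
  · exact hVdep X h
  · rfl

/-- A truncation keeps the summable link majorant. -/
theorem IsLinkSummable.indicator {BV : Finset (ZdEdge d) → ℝ} (hV : IsLinkSummable V BV) : IsLinkSummable (T.indicator V) BV where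
  abs_le X U := by
    classical
    rw [Set.indicator_apply]
    split_ifs
    · exact hV.abs_le X U
    · simp only [Pi.zero_apply, abs_zero]; exact hV.nonneg X U
  summable := hV.summable

/-- An oscillation bound of `V_X` is one of the truncated term (which is `V_X` or `0`). -/
theorem isOscBound_indicator_apply {S : Type*} {f : Finset (ZdEdge d) → (ZdEdge d → S) → ℝ} {osc : Finset (ZdEdge d) → ZdEdge d → ℝ}
    (h : ∀ X, Dobrushin.IsOscBound (f X) (osc X)) (X : Finset (ZdEdge d)) :
    Dobrushin.IsOscBound (T.indicator f X) (osc X) := by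
  classical
  rw [Set.indicator_apply]
  split_ifs
  · exact h X
  · exact ⟨(h X).nonneg, fun y σ τ _ => by simp only [Pi.zero_apply, sub_self, abs_zero]; exact (h X).nonneg y⟩

/-- A Lipschitz bound of `V_X` is one of the truncated term. -/
theorem isLipBound_indicator_apply {S : Type*} {r : S → S → ℝ} (hr : ∀ a b, 0 ≤ r a b) {f : Finset (ZdEdge d) → (ZdEdge d → S) → ℝ}
    {lip : Finset (ZdEdge d) → ZdEdge d → ℝ} (h : ∀ X, IsLipBound r (f X) (lip X)) (X : Finset (ZdEdge d)) :
    IsLipBound r (T.indicator f X) (lip X) := by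
  classical
  rw [Set.indicator_apply]
  split_ifs
  · exact h X
  · exact ⟨(h X).nonneg, fun y σ τ _ => by
      simp only [Pi.zero_apply, sub_self, abs_zero]; exact mul_nonneg ((h X).nonneg y) (hr _ _)⟩

end Truncation

section Ball

variable {a Λ aV ΛV t : ℝ} {W V : Potential (ZdEdge d) (Matrix.specialUnitaryGroup (Fin N) ℂ)}

/-- **Truncated directions stay in the ball**, with the same loads. -/
theorem memBallZdS_indicator (hV : MemBallZdS aV ΛV t V) (T : Set (Finset (ZdEdge d))) : MemBallZdS aV ΛV t (T.indicator V) := by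
  obtain ⟨osc, lip, ℓ, h1, h2, h3, h4, h5, h6, h7, h8⟩ := hV.loads
  obtain ⟨BV, hBV⟩ := hV.summable
  exact ⟨continuous_indicator_apply hV.continuous, dependsOn_indicator_apply hV.dependsOn, ⟨BV, hBV.indicator⟩,
    osc, lip, ℓ, isOscBound_indicator_apply h1, isLipBound_indicator_apply (fun _ _ => suFrobDist_nonneg _ _) h2,
    h3, h4, h5, h6, h7, h8⟩

/-- **Truncated lines stay in the ball**: `W ∈ Ball(a, Λ, t)`, `V ∈ Ball(a_V, Λ_V, t)`, `|s| ≤ s₀`, `a + s₀ a_V ≤ a'`, `Λ + s₀ Λ_V ≤ Λ'` give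
`W + s·𝟙_T V ∈ Ball(a', Λ', t)` for every set of terms `T` (and `T = univ` is the full line). -/
theorem memBallZdS_add_smul_indicator (hW : MemBallZdS a Λ t W) (hV : MemBallZdS aV ΛV t V) (haV : 0 ≤ aV) (hΛV : 0 ≤ ΛV)
    {s₀ a' Λ' : ℝ} (ha' : a + s₀ * aV ≤ a') (hΛ' : Λ + s₀ * ΛV ≤ Λ') {s : ℝ} (hs : |s| ≤ s₀) (T : Set (Finset (ZdEdge d))) :
    MemBallZdS a' Λ' t (W + s • T.indicator V) :=
  (hW.add ((memBallZdS_indicator hV T).smul s)).mono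
    ((add_le_add le_rfl (mul_le_mul_of_nonneg_right hs haV)).trans ha')
    ((add_le_add le_rfl (mul_le_mul_of_nonneg_right hs hΛV)).trans hΛ')

/-- **DLR selections along a line exist**: for `W, V` in the weighted ball there is `ν : ℝ → states` with `ν(s) ∈ 𝒢(W + sV)` for every real
`s` (compactness: `perturbedGibbsMeasuresS_nonempty`), so the «for every selection» theorems of this lane are never vacuous. -/
theorem exists_selection_add_smul (β : ℝ) (hW : MemBallZdS a Λ t W) (hV : MemBallZdS aV ΛV t V) :
    ∃ ν : ℝ → Measure (LGConfig d (Matrix.specialUnitaryGroup (Fin N) ℂ)),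
      ∀ s, ν s ∈ perturbedGibbsMeasuresS (d := d) (fundamentalRep (Fin N)) β (W + s • V) := by
  haveI : SecondCountableTopology (Matrix (Fin N) (Fin N) ℂ) :=
    inferInstanceAs (SecondCountableTopology (Fin N → Fin N → ℂ))
  haveI : SecondCountableTopology (Matrix.specialUnitaryGroup (Fin N) ℂ) :=
    Topology.IsEmbedding.subtypeVal.secondCountableTopology
  have hne : ∀ s : ℝ, (perturbedGibbsMeasuresS (d := d) (fundamentalRep (Fin N)) β (W + s • V)).Nonempty := fun s => by
    have hm := hW.add (hV.smul s)
    obtain ⟨B, hB⟩ := hm.summable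
    exact perturbedGibbsMeasuresS_nonempty _ (continuous_fundamentalRep (Fin N)) _ hB hm.continuous hm.dependsOn
  choose ν hν using hne
  exact ⟨ν, hν⟩

/-- **DLR selections along the coupling exist**: for `W` in the weighted ball there is `ν` with `ν(b) ∈ 𝒢(perturbedYMS b W)` for every real
coupling parameter `b`. -/
theorem exists_selection_coupling (hW : MemBallZdS a Λ t W) :
    ∃ ν : ℝ → Measure (LGConfig d (Matrix.specialUnitaryGroup (Fin N) ℂ)),
      ∀ b, ν b ∈ perturbedGibbsMeasuresS (d := d) (fundamentalRep (Fin N)) b W := by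
  haveI : SecondCountableTopology (Matrix (Fin N) (Fin N) ℂ) :=
    inferInstanceAs (SecondCountableTopology (Fin N → Fin N → ℂ))
  haveI : SecondCountableTopology (Matrix.specialUnitaryGroup (Fin N) ℂ) :=
    Topology.IsEmbedding.subtypeVal.secondCountableTopology
  obtain ⟨B, hB⟩ := hW.summable
  choose ν hν using fun b : ℝ =>
    perturbedGibbsMeasuresS_nonempty _ (continuous_fundamentalRep (Fin N)) b hB hW.continuous hW.dependsOn
  exact ⟨ν, hν⟩

/-- `(W + s·𝟙_T V) + s·𝟙_{Tᶜ} V = W + s V`. -/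
theorem add_smul_indicator_add_compl (W V : Potential (ZdEdge d) (Matrix.specialUnitaryGroup (Fin N) ℂ)) (s : ℝ)
    (T : Set (Finset (ZdEdge d))) : W + s • T.indicator V + s • Tᶜ.indicator V = W + s • V := by
  rw [add_assoc, ← smul_add, Set.indicator_self_add_compl]

end Ball

/-! ### The switched-off remainder: loads and their tails -/

section Tails

variable {V : Potential (ZdEdge d) (Matrix.specialUnitaryGroup (Fin N) ℂ)} {oscV : Finset (ZdEdge d) → ZdEdge d → ℝ}

/-- Oscillation witnesses of the remainder `s·𝟙_{Tᶜ} V`: `|s|·osc_X` off `T`, `0` on `T`. -/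
theorem isOscBound_smul_compl_indicator (hoscV : ∀ X, Dobrushin.IsOscBound (V X) (oscV X)) (s : ℝ)
    (Tf : Finset (Finset (ZdEdge d))) (X : Finset (ZdEdge d)) :
    Dobrushin.IsOscBound ((s • (↑Tf : Set (Finset (ZdEdge d)))ᶜ.indicator V) X)
      (fun e => |s| * (if X ∈ Tf then 0 else oscV X e)) := by
  classical
  refine ⟨fun e => mul_nonneg (abs_nonneg s) (by split_ifs; exacts [le_rfl, (hoscV X).nonneg e]), fun e σ τ hστ => ?_⟩
  simp only [Pi.smul_apply, Set.indicator_apply, Set.mem_compl_iff, Finset.mem_coe, smul_eq_mul]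
  split_ifs with hX
  · simp
  · rw [← mul_sub, abs_mul]
    exact mul_le_mul_of_nonneg_left ((hoscV X).le e σ τ hστ) (abs_nonneg s)

/-- The remainder's oscillation witnesses are summable through every link (dominated by those of `V`). -/
theorem summable_osc_smul_compl_indicator (hoscV : ∀ X, Dobrushin.IsOscBound (V X) (oscV X))
    (hoscVs : ∀ e, Summable fun X : Finset (ZdEdge d) => (if e ∈ X then oscV X e else 0)) (s : ℝ)
    (Tf : Finset (Finset (ZdEdge d))) (e : ZdEdge d) :
    Summable fun X : Finset (ZdEdge d) => (if e ∈ X then |s| * (if X ∈ Tf then 0 else oscV X e) else 0) := by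
  classical
  refine Summable.of_nonneg_of_le (fun X => ?_) (fun X => ?_) ((hoscVs e).mul_left |s|)
  · split_ifs <;> first | positivity | exact le_rfl |>.trans (le_refl _) | exact mul_nonneg (abs_nonneg s) ((hoscV X).nonneg e)
  · split_ifs with he hX
    · simp only [mul_zero]; exact mul_nonneg (abs_nonneg s) ((hoscV X).nonneg e)
    · exact le_rfl
    · simp

/-- **The remainder's one-link oscillation load is `|s|` times the TAIL** `Σ'_{X ∋ e, X ∉ T} osc_X(e)` of the direction's load series. -/
theorem oscLoad_compl_indicator (oscV : Finset (ZdEdge d) → ZdEdge d → ℝ) (s : ℝ)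
    (Tf : Finset (Finset (ZdEdge d))) (e : ZdEdge d) :
    ∑' X : Finset (ZdEdge d), (if e ∈ X then |s| * (if X ∈ Tf then 0 else oscV X e) else 0) =
      |s| * ∑' X : {X : Finset (ZdEdge d) // X ∉ Tf}, (if e ∈ (X : Finset (ZdEdge d)) then oscV X e else 0) := by
  classical
  set u : Finset (ZdEdge d) → ℝ := fun X => if e ∈ X then oscV X e else 0 with hu
  have h : ∑' X : {X : Finset (ZdEdge d) // X ∉ Tf}, u X = ∑' X, ((↑Tf : Set (Finset (ZdEdge d)))ᶜ).indicator u X :=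
    tsum_subtype _ u
  have h2 : ∀ X, ((↑Tf : Set (Finset (ZdEdge d)))ᶜ).indicator u X = if X ∈ Tf then 0 else u X := fun X => by
    simp only [Set.indicator_apply, Set.mem_compl_iff, Finset.mem_coe]
    split_ifs <;> simp_all
  rw [h, ← tsum_mul_left]
  refine tsum_congr fun X => ?_
  rw [h2 X]
  simp only [hu]
  split_ifs <;> simp

/-- The tail is at most the full load. -/
theorem tail_oscLoad_le (hoscV : ∀ X, Dobrushin.IsOscBound (V X) (oscV X))
    (hoscVs : ∀ e, Summable fun X : Finset (ZdEdge d) => (if e ∈ X then oscV X e else 0)) {aV : ℝ}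
    (hoscVa : ∀ e, ∑' X : Finset (ZdEdge d), (if e ∈ X then oscV X e else 0) ≤ aV)
    (Tf : Finset (Finset (ZdEdge d))) (e : ZdEdge d) :
    ∑' X : {X : Finset (ZdEdge d) // X ∉ Tf}, (if e ∈ (X : Finset (ZdEdge d)) then oscV X e else 0) ≤ aV := by
  classical
  have h0 : ∀ X : Finset (ZdEdge d), 0 ≤ (if e ∈ X then oscV X e else 0) := fun X => by
    split_ifs; exacts [(hoscV X).nonneg e, le_rfl]
  have h := (hoscVs e).sum_add_tsum_subtype_compl Tf
  have h1 : 0 ≤ ∑ X ∈ Tf, (if e ∈ X then oscV X e else 0) := sum_nonneg fun X _ => h0 X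
  linarith [hoscVa e]

/-- **The tails tend to zero at every link along an exhausting sequence of finite term sets.** -/
theorem tendsto_tail_oscLoad (oscV : Finset (ZdEdge d) → ZdEdge d → ℝ)
    {T : ℕ → Finset (Finset (ZdEdge d))} (hT : Tendsto T atTop atTop) (e : ZdEdge d) :
    Tendsto (fun n => ∑' X : {X : Finset (ZdEdge d) // X ∉ T n}, (if e ∈ (X : Finset (ZdEdge d)) then oscV X e else 0))
      atTop (𝓝 0) :=
  (tendsto_tsum_compl_atTop_zero fun X : Finset (ZdEdge d) => if e ∈ X then oscV X e else 0).comp hT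

/-- An exhausting sequence of finite TERM sets exists (the index type is countable; cf. `exists_exhaustion` for link sets). -/
theorem exists_term_exhaustion (d : ℕ) : ∃ T : ℕ → Finset (Finset (ZdEdge d)), Tendsto T atTop atTop :=
  Filter.exists_seq_tendsto (atTop : Filter (Finset (Finset (ZdEdge d))))

end Tails

/-! ### The near set is finite -/

/-- The links within `ℓ^∞` base-point distance `r` of a nonempty finite link set form a finite set. -/
theorem finite_near_links {Δ : Finset (ZdEdge d)} (hΔ : Δ.Nonempty) (r : ℝ) : Set.Finite {e : ZdEdge d | linkSetDist Δ e ≤ r} := by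
  have hball : ∀ y : Site d, Set.Finite {x : Site d | ‖x - y‖ ≤ r} := fun y => by
    have hsub : {x : Site d | ‖x - y‖ ≤ r} ⊆ Set.pi Set.univ (fun k => Set.Icc (y k - ⌈r⌉) (y k + ⌈r⌉)) := by
      intro x hx
      simp only [Set.mem_setOf_eq] at hx
      intro k _
      have h1 : ‖(x - y) k‖ ≤ ‖x - y‖ := norm_le_pi_norm (x - y) k
      rw [Pi.sub_apply, Int.norm_eq_abs] at h1
      have h2 : |((x k - y k : ℤ) : ℝ)| ≤ ⌈r⌉ := by
        have := h1.trans hx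
        push_cast at this ⊢
        exact this.trans (Int.le_ceil r)
      have h3 : |x k - y k| ≤ ⌈r⌉ := by exact_mod_cast h2
      rw [abs_le] at h3
      constructor <;> omega
    exact (Set.Finite.pi fun k => Set.finite_Icc _ _).subset hsub
  have hsub : {e : ZdEdge d | linkSetDist Δ e ≤ r} ⊆ ⋃ y ∈ (↑Δ : Set (ZdEdge d)), (fun p : Site d × Fin d => (p : ZdEdge d)) ''
      ({x : Site d | ‖x - y.1‖ ≤ r} ×ˢ Set.univ) := by
    intro e he
    simp only [Set.mem_setOf_eq] at he
    obtain ⟨y, hy, heq⟩ := Finset.exists_mem_eq_inf' hΔ (fun y' : ZdEdge d => ‖e.1 - y'.1‖)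
    have hD : linkSetDist Δ e = ‖e.1 - y.1‖ := by unfold linkSetDist; rw [dif_pos hΔ, heq]
    refine Set.mem_iUnion₂.2 ⟨y, hy, ⟨(e.1, e.2), ⟨by simpa [hD] using he, Set.mem_univ _⟩, rfl⟩⟩
  refine Set.Finite.subset (Set.Finite.biUnion Δ.finite_toSet fun y _ => Set.Finite.image _ ((hball y.1).prod Set.finite_univ)) hsub

/-! ### Uniform convergence along the truncations -/

section Convergence

open Summit.QuantumFields.BalabanUV.InfraRed.StrongCouplingPoincareDoorSUN (oneLinkPoincareSUN_two_sharp)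

variable {W V : Potential (ZdEdge d) (Matrix.specialUnitaryGroup (Fin N) ℂ)}

/-- ★ **EXPECTATIONS ALONG THE LINE `s ↦ W + sV` ARE UNIFORM LIMITS OF THE EXPECTATIONS ALONG ITS TRUNCATIONS.**  Member `W ∈ Ball(a, Λ, t)`,
direction `V ∈ Ball(a_V, Λ_V, t)`, `a + s₀ a_V ≤ a'`, `Λ + s₀ Λ_V ≤ Λ'`, pair door `ρ' < 1` at `(a', Λ', t)`, `t > 0`; `T_n ↑` an exhausting
sequence of finite term sets; ANY selections `ν_n(s) ∈ 𝒢(W + s·𝟙_{T_n} V)`, `ν(s) ∈ 𝒢(W + sV)` on `|s| ≤ s₀`; `g` bounded measurable local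
(on `Δ`) with Frobenius-Lipschitz vector `δ`.  Then `∫ g dν_n(s) → ∫ g dν(s)` uniformly on `[−s₀, s₀]`. -/
theorem tendstoUniformlyOn_integral_truncation_S (hd : 1 ≤ d) (hN : 1 ≤ N) {β b c v a' Λ' t : ℝ}
    (hc : 0 ≤ c) (hv : 0 ≤ v) (hb : |β| * (2 * ((d : ℝ) - 1)) ≤ b)
    (hP : ∀ B : Matrix (Fin N) (Fin N) ℂ, matrixOpNorm B ≤ b →
      ∀ (ψ : Matrix.specialUnitaryGroup (Fin N) ℂ → ℝ) (M : ℝ), 0 ≤ M →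
        (∀ x y, |ψ x - ψ y| ≤ M * suFrobDist x y) →
        Var[ψ; (haarProbability (Matrix.specialUnitaryGroup (Fin N) ℂ)).tilted
          fun g => (N : ℝ) * ((g : Matrix (Fin N) (Fin N) ℂ) * B).trace.re] ≤ c * M ^ 2)
    (hVB : ∀ B : Matrix (Fin N) (Fin N) ℂ, matrixOpNorm B ≤ b → ∀ Δ : Matrix (Fin N) (Fin N) ℂ,
      Var[fun g : Matrix.specialUnitaryGroup (Fin N) ℂ =>
          (N : ℝ) * ((g : Matrix (Fin N) (Fin N) ℂ) * Δ).trace.re;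
        (haarProbability (Matrix.specialUnitaryGroup (Fin N) ℂ)).tilted
          fun g => (N : ℝ) * ((g : Matrix (Fin N) (Fin N) ℂ) * B).trace.re] ≤ v * frobNorm Δ ^ 2)
    (ht : 0 < t) (hρ : 6 * ((d : ℝ) - 1) * |β| * (exp a' * exp t * Real.sqrt (c * v)) + exp (a' / 2) * Real.sqrt c * Λ' < 1)
    {a Λ aV ΛV s₀ : ℝ} (hW : MemBallZdS a Λ t W) (hV : MemBallZdS aV ΛV t V) (haV : 0 ≤ aV) (hΛV : 0 ≤ ΛV)
    (hs₀ : 0 ≤ s₀) (ha' : a + s₀ * aV ≤ a') (hΛ' : Λ + s₀ * ΛV ≤ Λ')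
    {T : ℕ → Finset (Finset (ZdEdge d))} (hT : Tendsto T atTop atTop)
    {νn : ℕ → ℝ → Measure (LGConfig d (Matrix.specialUnitaryGroup (Fin N) ℂ))}
    (hνn : ∀ n, ∀ s ∈ Set.Icc (-s₀) s₀, νn n s ∈ perturbedGibbsMeasuresS (d := d) (fundamentalRep (Fin N)) (N * β)
      (W + s • (↑(T n) : Set (Finset (ZdEdge d))).indicator V))
    {ν : ℝ → Measure (LGConfig d (Matrix.specialUnitaryGroup (Fin N) ℂ))}
    (hν : ∀ s ∈ Set.Icc (-s₀) s₀, ν s ∈ perturbedGibbsMeasuresS (d := d) (fundamentalRep (Fin N)) (N * β) (W + s • V))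
    {g : LGConfig d (Matrix.specialUnitaryGroup (Fin N) ℂ) → ℝ} (hgm : Measurable g) {Δ : Finset (ZdEdge d)}
    (hgdep : DependsOn g (↑Δ : Set (ZdEdge d))) {M : ℝ} (hM : ∀ σ, |g σ| ≤ M) {δ : ZdEdge d → ℝ}
    (hδ : IsLipBound suFrobDist g δ) :
    TendstoUniformlyOn (fun n s => ∫ σ, g σ ∂(νn n s)) (fun s => ∫ σ, g σ ∂(ν s)) atTop (Set.Icc (-s₀) s₀) := by
  classical
  rw [Metric.tendstoUniformlyOn_iff]
  intro ε hε
  set ρ' : ℝ := 6 * ((d : ℝ) - 1) * |β| * (exp a' * exp t * Real.sqrt (c * v)) + exp (a' / 2) * Real.sqrt c * Λ' with hρ'def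
  have h1ρ : 0 < 1 - ρ' := sub_pos.2 hρ
  set Sδ : ℝ := ∑ y ∈ Δ, δ y with hSδ
  have hSδ0 : 0 ≤ Sδ := sum_nonneg fun y _ => hδ.nonneg y
  set C : ℝ := Real.sqrt N / 2 / (1 - ρ') * Sδ with hCdef
  have hC0 : 0 ≤ C := by positivity
  have habs : ∀ {s}, s ∈ Set.Icc (-s₀) s₀ → |s| ≤ s₀ := fun hs => abs_le.2 ⟨by linarith [hs.1], hs.2⟩
  -- the constant observable (empty support) is trivial
  by_cases hΔ : Δ.Nonempty
  swap
  · refine Eventually.of_forall fun n s hs => ?_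
    have hμ1 : IsGibbsMeasure _ (νn n s) := hνn n s hs
    have hμ2 : IsGibbsMeasure _ (ν s) := hν s hs
    haveI := hμ1.isProbabilityMeasure
    haveI := hμ2.isProbabilityMeasure
    obtain ⟨σ₀⟩ : Nonempty (LGConfig d (Matrix.specialUnitaryGroup (Fin N) ℂ)) := ⟨fun _ => 1⟩
    have hconst : g = fun _ => g σ₀ := funext fun σ => hgdep (fun e he => by
      simp [Finset.not_nonempty_iff_eq_empty.1 hΔ] at he)
    rw [hconst]
    simp only [integral_const, probReal_univ, one_smul, dist_self]
    exact hε
  -- far: a radius `r` beyond which the full load `≤ s₀ a_V` is screened below `ε/2`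
  obtain ⟨r, hr0, hr⟩ : ∃ r : ℝ, 0 ≤ r ∧ C * 4 * exp (-t * r) < ε / 2 := by
    have h1 : Tendsto (fun r : ℝ => C * 4 * exp (-(t * r))) atTop (𝓝 (C * 4 * 0)) :=
      (Real.tendsto_exp_neg_atTop_nhds_zero.comp (tendsto_id.const_mul_atTop ht)).const_mul _
    rw [mul_zero] at h1
    obtain ⟨r, hr1, hr2⟩ := ((h1.eventually (eventually_lt_nhds (by linarith : (0 : ℝ) < ε / 2))).and
      (eventually_ge_atTop 0)).exists
    exact ⟨r, hr2, by rw [neg_mul]; simpa using hr1⟩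
  -- near: the finitely many links within `r` of `Δ`, where the remainder's load tends to zero
  obtain ⟨oscV, -, -, hoscV, -, hoscVs, hoscVa, -, -, -, -⟩ := hV.loads
  obtain ⟨BV, hBV⟩ := hV.summable
  set S : Finset (ZdEdge d) := (finite_near_links hΔ r).toFinset with hSdef
  set ε' : ℝ := ε / (4 * (C * s₀ + 1)) with hε'def
  have hCs : 0 ≤ C * s₀ := mul_nonneg hC0 hs₀
  have hε' : 0 < ε' := by positivity
  have hnear : ∀ᶠ n in atTop, ∀ e ∈ S,
      ∑' X : {X : Finset (ZdEdge d) // X ∉ T n}, (if e ∈ (X : Finset (ZdEdge d)) then oscV X e else 0) < ε' :=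
    (S.eventually_all).2 fun e _ => (tendsto_tail_oscLoad oscV hT e).eventually (eventually_lt_nhds hε')
  filter_upwards [hnear] with n hn s hs
  rw [Real.dist_eq, abs_sub_comm]
  -- the member `W + s·𝟙_{T n} V` and the remainder `s·𝟙_{(T n)ᶜ} V`
  set Tn : Set (Finset (ZdEdge d)) := ↑(T n) with hTn
  have hmem := memBallZdS_add_smul_indicator hW hV haV hΛV ha' hΛ' (habs hs) Tn
  obtain ⟨BW, hBW⟩ := hmem.summable
  obtain ⟨osc, lip, ℓ, hosc, hlip, hoscs, hosca, hlips, hℓ, hℓs, hℓt⟩ := hmem.loads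
  have hV'sum : IsLinkSummable (s • Tnᶜ.indicator V) (fun X => |s| * BV X) := hBV.indicator.smul s
  have hV'c : ∀ X, Continuous ((s • Tnᶜ.indicator V) X) := fun X =>
    (continuous_indicator_apply hV.continuous X).const_smul s
  have hV'dep : ∀ X, DependsOn ((s • Tnᶜ.indicator V) X) (↑X : Set (ZdEdge d)) := fun X σ τ h => by
    simp only [Pi.smul_apply, smul_eq_mul]
    rw [dependsOn_indicator_apply hV.dependsOn X h]
  have hoscV' := isOscBound_smul_compl_indicator hoscV s (T n)
  have hoscV's := summable_osc_smul_compl_indicator hoscV hoscVs s (T n)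
  set bV : ZdEdge d → ℝ := fun e =>
    |s| * ∑' X : {X : Finset (ZdEdge d) // X ∉ T n}, (if e ∈ (X : Finset (ZdEdge d)) then oscV X e else 0) with hbVdef
  have hbV : ∀ e, ∑' X : Finset (ZdEdge d), (if e ∈ X then |s| * (if X ∈ T n then 0 else oscV X e) else 0) ≤ bV e :=
    fun e => (oscLoad_compl_indicator oscV s (T n) e).le
  have hη₁ : ∀ e, bV e ≤ s₀ * aV := fun e =>
    mul_le_mul (habs hs) (tail_oscLoad_le hoscV hoscVs hoscVa (T n) e) (tsum_nonneg fun X => by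
      split_ifs; exacts [(hoscV X).nonneg e, le_rfl]) hs₀
  have hη₀ : ∀ e, linkSetDist Δ e ≤ r → bV e ≤ s₀ * ε' := fun e he => by
    have heS : e ∈ S := by rw [hSdef, Set.Finite.mem_toFinset]; exact he
    exact mul_le_mul (habs hs) (hn e heS).le (tsum_nonneg fun X => by split_ifs; exacts [(hoscV X).nonneg e, le_rfl]) hs₀
  have hνs : ν s ∈ perturbedGibbsMeasuresS (d := d) (fundamentalRep (Fin N)) (N * β)
      (W + s • Tn.indicator V + s • Tnᶜ.indicator V) := by
    rw [add_smul_indicator_add_compl]; exact hν s hs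
  have key := abs_integral_sub_integral_le_of_perturbation_screened_S hd hN hc hv hb hP hVB hBW hmem.continuous hmem.dependsOn
    hosc hoscs hosca hlip hlips hℓ ht.le hℓs hℓt hρ hV'sum hV'c hV'dep hoscV' hoscV's hbV hη₁ hr0 hη₀ (hνn n s hs) hνs
    hgm hgdep hM hδ
  -- bookkeeping: `C·(min(s₀ε',4) + min(s₀ a_V,4)·e^{−tr}) < ε`
  have hmin₀ : min (s₀ * ε') 4 ≤ s₀ * ε' := min_le_left _ _
  have hmin₁ : min (s₀ * aV) 4 ≤ 4 := min_le_right _ _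
  have hexp0 : 0 ≤ exp (-t * r) := (exp_pos _).le
  have h4 : C * (s₀ * ε') ≤ ε / 4 := by
    have hden : 0 < 4 * (C * s₀ + 1) := by positivity
    rw [show C * (s₀ * ε') = C * s₀ * ε / (4 * (C * s₀ + 1)) by rw [hε'def]; ring,
      div_le_div_iff₀ hden (by norm_num : (0 : ℝ) < 4)]
    nlinarith [hε.le]
  calc |(∫ σ, g σ ∂(νn n s)) - ∫ σ, g σ ∂(ν s)|
      ≤ Real.sqrt N / 2 * (min (s₀ * ε') 4 + min (s₀ * aV) 4 * exp (-t * r)) / (1 - ρ') * Sδ := key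
    _ = C * (min (s₀ * ε') 4 + min (s₀ * aV) 4 * exp (-t * r)) := by rw [hCdef]; ring
    _ ≤ C * (s₀ * ε' + 4 * exp (-t * r)) := by
        refine mul_le_mul_of_nonneg_left (add_le_add hmin₀ (mul_le_mul_of_nonneg_right hmin₁ hexp0)) hC0
    _ = C * (s₀ * ε') + C * 4 * exp (-t * r) := by ring
    _ < ε := by linarith

end Convergence

end Summit.Ventures.YMGap.RobustBall

end
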